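import Literature.Barriers.RiemannHypothesis.TuranPartialSumsSharpProofs
import HarnessLib

/-!
# Turán's criterion with his own rate `log³ N/√N`, and for every rate `N^{−1/2+o(1)}` — proved

Barrier catalogue `Literature/Barriers/RiemannHypothesis/`, companion of `TuranPartialSums.lean`
(proofs only: no definitions, no named facts). This file DISCHARGES the named fact
`Turan1948_criterion_log3` — Roy–Vatwani 2019, §1: "Turán [Turan1948] … showed that if `ζ_N(s)` has
no zeros in the half-plane `σ > 1 + (log N)³/√N` for all `N` sufficiently large, then `ζ(s)` has no
zeros in `σ > 1/2`" — as `Turan1948_criterion_log3_holds`, by proving the implication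
`TuranHypothesisLog3 → RiemannHypothesis` along Turán's own route (not through the falsity of its
hypothesis, Montgomery 1983, `Turan1948_criterion_log3_of_montgomeryThm`). In fact Turán's criterion
is proved for EVERY rate `g` with `g(N) ≤ N^{−1/2+ε}` for all large `N`, every `ε > 0`
(`riemannHypothesis_of_TuranHypothesisRate`); the companions `TuranPartialSumsProofs.lean` (`g = 0`,
`Turan1948_criterion_holds`) and `TuranPartialSumsSharpProofs.lean` (`g = C/√N`,
`Turan1948_criterion_sharp_holds`) are the two extreme printed instances, the present rate
`log³ N/√N` lies in between, and the Landau step is done here once for the whole family.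

## The argument (Turán 1948, as summarised in Ingham's review MR 10,286b, with a rate)

Ingham's review of Turán 1948: "By a theorem of Bohr … the hypothesis `U_n(s) ≠ 0` (`σ > 1`,
`n > n₀`) is equivalent to `W_n(s) ≡ Σ₁ⁿ λ(ν) ν^{−s} ≠ 0` (`σ > 1`, `n > n₀`), and so implies
`W_n(σ) ≥ 0` (`σ ≥ 1`, `n > n₀`) …; and this implies, by a theorem of Landau, that the function on the
right of the identity `∫₁^∞ x^{−s} W_{[x]}(1) dx = ζ(2s)/((s−1)ζ(s))` (`σ > 1`), being regular along
the stretch `s > 1/2` of the real axis, is regular in the half-plane `σ > 1/2`"; and the reviewer's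
note: the weaker hypothesis with a rate implies RH "by way of … `W_n(1) > −K₂ n^{−1}`". With a rate
`g(N)`:

1. **Bohr's step and the descent to `σ = 1`** are the tree's (`TuranPartialSumsBohr.lean`,
   `TuranPartialSumsSharpProofs.lean`): if every zero of `ζ_N` has `Re s ≤ σ_N` then
   `W_N(σ_N) = Σ_{n ≤ N} λ(n) n^{−σ_N} ≥ 0` (`Turan1948.realTwistedSum_liouville_nonneg`), and
   `T(N) = W_N(1) ≥ W_N(σ) − (σ − 1) log N (1 + log N)` for `σ ≥ 1`
   (`Turan1948.realTwistedSum_one_ge`). With `σ_N = 1 + max(g(N), 0) ≤ 1 + N^{−1/2+ε/2}` and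
   `(1 + log N)² ≤ N^{ε/2}` eventually this gives, under `TuranHypothesisRate g`,
   **`T(N) ≥ −N^{−1/2+ε}` for all large `N`, every `ε > 0`**
   (`liouvilleHarmonicSum_ge_neg_rpow_of_rate`).
2. **Landau's step for the whole family** (`integrableOn_liouvilleHarmonicSum_rpow_of_ge_neg_rpow`):
   if `T(n) ≥ −n^{−1/2+ε}` for all large `n`, for every `ε > 0`, then `∫₁^∞ |T(x)| x^{−(σ+1)} dx < ∞`
   for EVERY `σ > −1/2`: given `σ`, take `ε = min((σ + 1/2)/2, 1/4)`, `a = −1/2 + ε < σ`; then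
   `g_ε(x) = T(x) + 2x^a ≥ 0` for large `x`, its transform is
   `ζ(2u+2)/ζ₁(u+1) + 2/(u − a)` (`Re u > 1`; `∫₁^∞ x^{a−u−1} dx = 1/(u − a)`, `mellinIoi_const_mul_rpow`),
   holomorphic along the real segment `(a, 3]` (`ζ₁ ≠ 0` near `[1/2, 5]`, the tree's
   `TuranLiouville.exists_strip_riemannZeta₁_ne_zero`), so Landau's lemma (MV Lemma 15.1, the tree's
   `Landau.integrableOn_of_differentiableOn_union_convex`) gives absolute convergence of the transform
   of `g_ε` at `σ`, and subtracting the compensator that of `T`. The tree's continuation argument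
   (`TuranLiouville.riemannZeta_ne_zero_of_integrable`: `(∫ T x^{−u−1}) ζ₁(u+1) = ζ(2u+2)` on
   `Re u > −1/2`, so a zero `ρ` with `1/2 < Re ρ < 1` would give `ζ(2ρ) = 0`) and
   `quasiRiemannHypothesis_one_half_iff_holds` finish: `riemannHypothesis_of_liouvilleHarmonicSum_ge_neg_rpow`.
3. `Turan1948_criterion_log3_holds`: `log³ N/√N ≤ N^{−1/2+ε}` eventually
   (`exists_log_pow_three_div_sqrt_le_rpow`).

## References

* [RoyVatwani2019] A. Roy, A. Vatwani, *Zeros of partial sums of L-functions*, Adv. Math. 346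
  (2019); arXiv:1807.11093, §1 (arXiv p. 3) — the statement discharged here (read).
* [Turan1948] P. Turán, *On some approximative Dirichlet-polynomials in the theory of the
  zeta-function of Riemann*, Danske Vid. Selsk. Mat.-Fys. Medd. 24 (1948), no. 17 — Theorem (I), its
  proof, the refinement (IV) and the reviewer's note, as reviewed by A. E. Ingham, MR 10,286b (read in
  *Reviews in Number Theory 1940–72*, N44; the paper itself is not held).
* [Titchmarsh1986] E. C. Titchmarsh, *The Theory of the Riemann Zeta-function*, 2nd ed., §14.32
  (Turán's sufficient condition), §14.38 ((14.38.1) implies RH) (read).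
* [MontgomeryVaughan2007] H. L. Montgomery, R. C. Vaughan, *Multiplicative Number Theory I*,
  §15.1, Lemma 15.1 (Landau's lemma; the tree's `LandauOscillation.lean`).

## Design notes

No new definitions: `T` is the tree's `liouvilleHarmonicSum`, the twisted sums are the tree's
`realTwistedSum (fun n ↦ (λ n : ℝ))`, the transform is the tree's `Landau.mellinIoi`. Helper lemmas
live in the sub-namespace `TuranLog3`; the rate-form criterion and the discharge are stated at
`Literature.Barriers.RiemannHypothesis`. The ε-family of compensators `2x^{−1/2+ε}` replaces the
single compensator `x^{−1/2}(1 + log x)²` of `TuranLiouvilleCriterionSharp.lean`, whose hypothesis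
`T(n) ≥ −K(1 + log n)²/√n` is too strong for the rate `log³ N/√N` (which only yields
`T(N) ≥ −(1 + log N)⁵/√N`).
-/

noncomputable section

open Complex Filter Set Metric MeasureTheory ArithmeticFunction Asymptotics
open scoped Topology

namespace Literature.Barriers.RiemannHypothesis

open Literature.NumberTheory.LFunctions Literature.NumberTheory.LFunctions.TuranLiouville

namespace TuranLog3

/-! ### Step 1: a Turán-type hypothesis of rate `N^{−1/2+o(1)}` gives `T(N) ≥ −N^{−1/2+ε}` -/

/-- Absorbing logarithms: for `δ > 0` and every `C`, eventually (over `ℕ`)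
`C (1 + log N)² ≤ N^δ` (`log² = o(x^δ)`). [folklore] -/
theorem exists_mul_one_add_log_sq_le_rpow (C : ℝ) {δ : ℝ} (hδ : 0 < δ) :
    ∃ N₁ : ℕ, ∀ N : ℕ, N₁ ≤ N → C * (1 + Real.log N) ^ 2 ≤ (N : ℝ) ^ δ := by
  rcases le_or_gt C 0 with hC | hC
  · refine ⟨1, fun N _ ↦ ?_⟩
    have : C * (1 + Real.log N) ^ 2 ≤ 0 := mul_nonpos_of_nonpos_of_nonneg hC (sq_nonneg _)
    exact this.trans (Real.rpow_nonneg (Nat.cast_nonneg N) _)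
  · have hlo := isLittleO_log_rpow_rpow_atTop (2 : ℝ) hδ
    have hc : (0 : ℝ) < 1 / (4 * C) := by positivity
    have hev := (isLittleO_iff.1 hlo) hc
    have hev2 : ∀ᶠ x : ℝ in atTop, C * (1 + Real.log x) ^ 2 ≤ x ^ δ := by
      filter_upwards [hev, eventually_ge_atTop (Real.exp 1)] with x hx hxe
      have hx0 : 0 < x := (Real.exp_pos 1).trans_le hxe
      have hlog1 : 1 ≤ Real.log x := by
        rw [← Real.log_exp 1]
        exact Real.log_le_log (Real.exp_pos 1) hxe
      rw [Real.rpow_two, Real.norm_eq_abs, Real.norm_eq_abs, abs_of_nonneg (sq_nonneg _),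
        abs_of_nonneg (Real.rpow_nonneg hx0.le _)] at hx
      have h1 : (1 + Real.log x) ^ 2 ≤ 4 * Real.log x ^ 2 := by nlinarith
      calc C * (1 + Real.log x) ^ 2 ≤ C * (4 * Real.log x ^ 2) :=
            mul_le_mul_of_nonneg_left h1 hC.le
        _ ≤ C * (4 * (1 / (4 * C) * x ^ δ)) := by gcongr
        _ = x ^ δ := by field_simp
    obtain ⟨X, hX⟩ := eventually_atTop.1 hev2
    refine ⟨⌈X⌉₊, fun N hN ↦ hX N ?_⟩
    exact (Nat.le_ceil X).trans (by exact_mod_cast hN)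

/-- **The lower bound on `T(N)` produced by a Turán-type hypothesis of rate `N^{−1/2+o(1)}`.** If
all zeros of `ζ_N` have `Re s ≤ 1 + g(N)` for large `N` (`TuranHypothesisRate g`) and
`g(N) ≤ N^{−1/2+ε}` eventually for every `ε > 0`, then for every `ε > 0`, `T(N) ≥ −N^{−1/2+ε}` for all
large `N`. With `σ_N = 1 + max(g(N), 0) ≤ 1 + N^{−1/2+ε/2}`: `W_N(σ_N) ≥ 0` by Bohr's step (the tree's
`Turan1948.realTwistedSum_liouville_nonneg`), so `T(N) ≥ −(σ_N − 1) log N (1 + log N)` (the tree's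
`Turan1948.realTwistedSum_one_ge`), and `(1 + log N)² ≤ N^{ε/2}` eventually. This is the rate form
of "implies `W_n(σ) ≥ 0` (`σ ≥ 1`, `n > n₀`)", resp. "`W_n(1) > −K₂ n^{−1}`", in Turán's argument.
[cite: Turan1948, Theorem I, proof, and (IV) (MR 10,286b)] -/
theorem liouvilleHarmonicSum_ge_neg_rpow_of_rate {g : ℕ → ℝ} (hZ : TuranHypothesisRate g)
    (hg : ∀ ε : ℝ, 0 < ε → ∃ N₁ : ℕ, ∀ N : ℕ, N₁ ≤ N → g N ≤ (N : ℝ) ^ (-(1 / 2 : ℝ) + ε))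
    {ε : ℝ} (hε : 0 < ε) :
    ∃ N₁ : ℕ, ∀ N : ℕ, N₁ ≤ N → -(N : ℝ) ^ (-(1 / 2 : ℝ) + ε) ≤ liouvilleHarmonicSum N := by
  obtain ⟨N₀, hN₀⟩ := hZ
  obtain ⟨N₁, hN₁⟩ := hg (ε / 2) (half_pos hε)
  obtain ⟨N₂, hN₂⟩ := exists_mul_one_add_log_sq_le_rpow 1 (half_pos hε)
  refine ⟨max (max N₀ N₁) (max N₂ 1), fun N hN ↦ ?_⟩
  have hN0 : N₀ ≤ N := le_trans (le_trans (le_max_left _ _) (le_max_left _ _)) hN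
  have hN1 : N₁ ≤ N := le_trans (le_trans (le_max_right _ _) (le_max_left _ _)) hN
  have hN2 : N₂ ≤ N := le_trans (le_trans (le_max_left _ _) (le_max_right _ _)) hN
  have hNone : 1 ≤ N := le_trans (le_trans (le_max_right _ _) (le_max_right _ _)) hN
  have hNpos : (0 : ℝ) < N := by exact_mod_cast hNone
  have hlogN : 0 ≤ Real.log N := Real.log_nonneg (by exact_mod_cast hNone)
  set h : ℝ := (N : ℝ) ^ (-(1 / 2 : ℝ) + ε / 2) with hh
  have hhpos : 0 < h := Real.rpow_pos_of_pos hNpos _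
  -- every zero of `ζ_N` has real part `≤ σ_N = 1 + max (g N) 0`
  set σN : ℝ := 1 + max (g N) 0 with hσN
  have hσN1 : 1 ≤ σN := by
    rw [hσN]
    linarith [le_max_right (g N) 0]
  have hzeros : ∀ s : ℂ, zetaPartialSum N s = 0 → s.re ≤ σN := fun s hs ↦
    (hN₀ N hN0 s hs).trans (by rw [hσN]; linarith [le_max_left (g N) 0])
  -- Bohr + IVT (tree): `W_N(σ_N) ≥ 0`; descent to `σ = 1` (tree)
  have h0 := Turan1948.realTwistedSum_liouville_nonneg hNone hzeros
  have h1 := Turan1948.realTwistedSum_one_ge (χ := fun k : ℕ ↦ (liouville k : ℝ))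
    LiouvilleSum.abs_liouville_le_one hNone hσN1
  rw [Turan1948.realTwistedSum_liouville_one] at h1
  -- `σ_N − 1 ≤ h`, `log N (1 + log N) ≤ (1 + log N)² ≤ N^{ε/2}`, `h · N^{ε/2} = N^{−1/2+ε}`
  have hσ : σN - 1 ≤ h := by
    rw [hσN, add_sub_cancel_left]
    exact max_le (hN₁ N hN1) hhpos.le
  have hl : Real.log N * (1 + Real.log N) ≤ (1 + Real.log N) ^ 2 := by nlinarith
  have hlog := hN₂ N hN2
  rw [one_mul] at hlog
  have hsplit : (N : ℝ) ^ (-(1 / 2 : ℝ) + ε) = h * (N : ℝ) ^ (ε / 2) := by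
    rw [hh, ← Real.rpow_add hNpos]
    congr 1
    ring
  have h3 : (σN - 1) * (Real.log N * (1 + Real.log N)) ≤ h * (N : ℝ) ^ (ε / 2) :=
    calc (σN - 1) * (Real.log N * (1 + Real.log N))
        ≤ h * (Real.log N * (1 + Real.log N)) := mul_le_mul_of_nonneg_right hσ (by positivity)
      _ ≤ h * (1 + Real.log N) ^ 2 := mul_le_mul_of_nonneg_left hl hhpos.le
      _ ≤ h * (N : ℝ) ^ (ε / 2) := mul_le_mul_of_nonneg_left hlog hhpos.le
  rw [hsplit]
  linarith

/-! ### Step 2: Landau's lemma with the compensators `2x^{−1/2+ε}` -/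

/-- The transform of a compensator: `∫₁^∞ C x^a · x^{−(u+1)} dx = C/(u − a)` for `Re u > a`.
[folklore] -/
theorem mellinIoi_const_mul_rpow (C a : ℝ) {u : ℂ} (hu : a < u.re) :
    Landau.mellinIoi (fun x ↦ C * x ^ a) u = (C : ℂ) / (u - a) := by
  unfold Landau.mellinIoi
  have hre : ((a : ℂ) - (u + 1)).re < -1 := by
    simp only [sub_re, add_re, ofReal_re, one_re]
    linarith
  have key := integral_Ioi_cpow_of_lt hre zero_lt_one
  rw [ofReal_one, one_cpow, show (a : ℂ) - (u + 1) + 1 = -(u - a) by ring] at key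
  calc ∫ x in Ioi (1 : ℝ), ((C * x ^ a : ℝ) : ℂ) * (x : ℂ) ^ (-(u + 1))
      = ∫ x in Ioi (1 : ℝ), (C : ℂ) * (x : ℂ) ^ ((a : ℂ) - (u + 1)) := by
        refine setIntegral_congr_fun measurableSet_Ioi fun x hx ↦ ?_
        have hx0 : 0 < x := zero_lt_one.trans hx
        rw [ofReal_mul, ofReal_cpow hx0.le, sub_eq_add_neg, cpow_add _ _ (ofReal_ne_zero.2 hx0.ne'),
          mul_assoc]
    _ = (C : ℂ) * ∫ x in Ioi (1 : ℝ), (x : ℂ) ^ ((a : ℂ) - (u + 1)) := integral_const_mul _ _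
    _ = (C : ℂ) / (u - a) := by
        rw [key, neg_div_neg_eq, mul_one_div]

/-- A compensator `C x^a` converges absolutely against `x^{−(σ+1)}` on `(1, ∞)` as soon as `a < σ`
(`∫₁^∞ x^{a−σ−1} dx < ∞`). [folklore] -/
theorem integrableOn_const_mul_rpow_mul_rpow (C : ℝ) {a σ : ℝ} (h : a < σ) :
    IntegrableOn (fun x : ℝ ↦ C * x ^ a * x ^ (-(σ + 1))) (Ioi 1) := by
  have hI : IntegrableOn (fun x : ℝ ↦ x ^ (a - σ - 1)) (Ioi 1) :=
    integrableOn_Ioi_rpow_of_lt (by linarith) one_pos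
  have hIC : IntegrableOn (fun x : ℝ ↦ C * x ^ (a - σ - 1)) (Ioi 1) := hI.const_mul C
  refine IntegrableOn.congr_fun hIC (fun x hx ↦ ?_) measurableSet_Ioi
  have hx0 : 0 < x := zero_lt_one.trans hx
  rw [mul_assoc, ← Real.rpow_add hx0, show a + -(σ + 1) = a - σ - 1 by ring]

/-- **Landau's lemma with the compensators `2x^{−1/2+ε}`** (Turán 1948 / Ingham, MR 10,286b: "this
implies, by a theorem of Landau, that … being regular along the stretch `s > 1/2` of the real axis,
is regular in the half-plane `σ > 1/2`"). If for every `ε > 0`, `T(n) ≥ −n^{−1/2+ε}` for all large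
integers `n`, then `∫₁^∞ |T(x)| x^{−(σ+1)} dx < ∞` for every `σ > −1/2`. Proof: for
`ε = min((σ + 1/2)/2, 1/4)` and `a = −1/2 + ε` (`−1/2 < a < min(σ, 0)`), the function
`g(x) = T(x) + 2x^a` is `≥ 0` for large `x` (`x^a ≥ (2n)^a ≥ n^a/2` for `n = ⌊x⌋`), its transform
agrees on `Re u > 2` with `Φ(u) = ζ(2u+2)/ζ₁(u+1) + 2/(u − a)`, holomorphic on `{Re u > 2} ∪ W₀` for a
thin rectangle `W₀` about the real segment `(a, 4)`; Landau's lemma (MV Lemma 15.1, the tree's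
`Landau.integrableOn_of_differentiableOn_union_convex`) gives absolute convergence of the transform
of `g` at `σ > a`, and the compensator's transform converges there too.
[cite: Turan1948, Theorem I, proof (MR 10,286b)] [cite: MontgomeryVaughan2007, §15.1 Lemma 15.1] -/
theorem integrableOn_liouvilleHarmonicSum_rpow_of_ge_neg_rpow
    (h : ∀ ε : ℝ, 0 < ε → ∃ N₁ : ℕ, ∀ n : ℕ, N₁ ≤ n →
      -(n : ℝ) ^ (-(1 / 2 : ℝ) + ε) ≤ liouvilleHarmonicSum n)
    {σ : ℝ} (hσ : -1 / 2 < σ) :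
    IntegrableOn (fun x ↦ liouvilleHarmonicSum x * x ^ (-(σ + 1))) (Ioi 1) := by
  set ε : ℝ := min ((σ + 1 / 2) / 2) (1 / 4) with hε
  have hε0 : 0 < ε := lt_min (by linarith) (by norm_num)
  set a : ℝ := -(1 / 2 : ℝ) + ε with ha
  have ha0 : a < 0 := by
    have : ε ≤ 1 / 4 := min_le_right _ _
    rw [ha]; linarith
  have ha1 : -1 / 2 < a := by rw [ha]; linarith
  have haσ : a < σ := by
    have : ε ≤ (σ + 1 / 2) / 2 := min_le_left _ _
    rw [ha]; linarith
  obtain ⟨N₁, hN₁⟩ := h ε hε0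
  obtain ⟨δ, hδ, hfree⟩ := exists_strip_riemannZeta₁_ne_zero
  set T : ℝ → ℝ := liouvilleHarmonicSum with hT
  -- the non-negative function `g = T + 2 x^a`
  set g : ℝ → ℝ := fun x ↦ T x + 2 * x ^ a with hg
  have hmeasT : Measurable T := measurable_liouvilleHarmonicSum
  have hmeasP : Measurable fun x : ℝ ↦ 2 * x ^ a := measurable_const.mul (measurable_id.pow_const a)
  have hmeas : Measurable g := hmeasT.add hmeasP
  have hpos : ∀ x : ℝ, ((N₁ : ℝ) + 1) < x → 0 ≤ g x := by
    intro x hx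
    have hN₁0 : (0 : ℝ) ≤ N₁ := Nat.cast_nonneg N₁
    have hx0 : 0 < x := by linarith
    set n : ℕ := ⌊x⌋₊ with hn
    have hnN : N₁ ≤ n := Nat.le_floor (by linarith)
    have hn1 : 1 ≤ n := Nat.le_floor (by push_cast; linarith)
    have hnpos : (0 : ℝ) < n := by exact_mod_cast hn1
    have hxn : x < (n : ℝ) + 1 := Nat.lt_floor_add_one x
    have hTx : T x = T n := by
      rw [hT, liouvilleHarmonicSum, liouvilleHarmonicSum, Nat.floor_natCast]
    have hTn : -(n : ℝ) ^ a ≤ T n := hN₁ n hnN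
    have hn1' : (1 : ℝ) ≤ n := by exact_mod_cast hn1
    have h2n : x ≤ 2 * n := by linarith
    have hxa : (2 * (n : ℝ)) ^ a ≤ x ^ a := Real.rpow_le_rpow_of_nonpos hx0 h2n ha0.le
    have hmul : (2 * (n : ℝ)) ^ a = 2 ^ a * (n : ℝ) ^ a := Real.mul_rpow (by norm_num) hnpos.le
    have h2a : (1 / 2 : ℝ) ≤ 2 ^ a := by
      have : (2 : ℝ) ^ (-1 : ℝ) ≤ 2 ^ a := Real.rpow_le_rpow_of_exponent_le (by norm_num) (by linarith)
      rwa [Real.rpow_neg_one, ← one_div] at this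
    have hna : 0 ≤ (n : ℝ) ^ a := Real.rpow_nonneg hnpos.le _
    have hkey : (n : ℝ) ^ a ≤ 2 * x ^ a := by
      have := mul_le_mul_of_nonneg_right h2a hna
      rw [← hmul] at this
      linarith
    show 0 ≤ T x + 2 * x ^ a
    rw [hTx]
    linarith
  -- absolute convergence of the transform of `g` at `σ₁ = 2`
  have hintT : IntegrableOn (fun x ↦ T x * x ^ (-((2 : ℝ) + 1))) (Ioi 1) :=
    integrableOn_liouvilleHarmonicSum_mul_rpow one_lt_two
  have hintP : IntegrableOn (fun x : ℝ ↦ 2 * x ^ a * x ^ (-((2 : ℝ) + 1))) (Ioi 1) :=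
    integrableOn_const_mul_rpow_mul_rpow 2 (by linarith)
  have hint : IntegrableOn (fun x ↦ g x * x ^ (-((2 : ℝ) + 1))) (Ioi 1) := by
    have hsum : IntegrableOn ((fun x ↦ T x * x ^ (-((2 : ℝ) + 1))) +
        fun x : ℝ ↦ 2 * x ^ a * x ^ (-((2 : ℝ) + 1))) (Ioi 1) := IntegrableOn.add hintT hintP
    refine IntegrableOn.congr_fun hsum (fun x _ ↦ ?_) measurableSet_Ioi
    simp only [hg, Pi.add_apply]
    ring
  -- the thin rectangle `W₀` about the real segment `(a, 4)` and the continuation `Φ`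
  set W₀ : Set ℂ := ({u : ℂ | a < u.re} ∩ {u : ℂ | u.re < 4}) ∩
    ({u : ℂ | u.im < δ} ∩ {u : ℂ | -δ < u.im}) with hW₀
  have hW₀o : IsOpen W₀ :=
    ((isOpen_lt continuous_const continuous_re).inter (isOpen_lt continuous_re continuous_const)).inter
      ((isOpen_lt continuous_im continuous_const).inter (isOpen_lt continuous_const continuous_im))
  have hW₀c : Convex ℝ W₀ :=
    ((convex_halfSpace_re_gt _).inter (convex_halfSpace_re_lt _)).inter
      ((convex_halfSpace_im_lt _).inter (convex_halfSpace_im_gt _))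
  have hW₀r : ∀ σ' : ℝ, a < σ' → σ' ≤ 2 + 1 → (σ' : ℂ) ∈ W₀ := fun σ' hσ1 hσ2 ↦ by
    refine ⟨⟨?_, ?_⟩, ?_, ?_⟩ <;> simp only [mem_setOf_eq, ofReal_re, ofReal_im] <;> linarith
  set Φ : ℂ → ℂ := fun u ↦ riemannZeta (2 * u + 2) / riemannZeta₁ (u + 1) + 2 / (u - a) with hΦ
  have hdom : ∀ u ∈ {s : ℂ | 2 < s.re} ∪ W₀, a < u.re ∧ riemannZeta₁ (u + 1) ≠ 0 := by
    rintro u (hu | ⟨⟨hu1, hu2⟩, hu3, hu4⟩)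
    · have hu' : 2 < u.re := hu
      refine ⟨by linarith, ?_⟩
      have hne : u + 1 ≠ 1 := by
        intro h
        have := congrArg Complex.re h
        simp only [add_re, one_re] at this
        linarith
      have hζ : riemannZeta (u + 1) ≠ 0 :=
        riemannZeta_ne_zero_of_one_lt_re (by simp only [add_re, one_re]; linarith)
      intro h0
      have h := riemannZeta_eq_inv_sub_mul hne
      rw [h0, mul_zero] at h
      exact hζ h
    · have hu1' : a < u.re := hu1
      have hu2' : u.re < 4 := hu2
      have hu3' : u.im < δ := hu3
      have hu4' : -δ < u.im := hu4
      refine ⟨hu1', hfree (u + 1) ?_ ?_ ?_⟩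
      · simp only [add_re, one_re]; linarith
      · simp only [add_re, one_re]; linarith
      · simp only [add_im, one_im, add_zero]
        exact abs_lt.2 ⟨hu4', hu3'⟩
  have hsub_ne : ∀ u : ℂ, a < u.re → u - a ≠ 0 := fun u hu h ↦ by
    have := congrArg Complex.re h
    simp only [sub_re, ofReal_re, zero_re] at this
    linarith
  have hInv : ∀ u : ℂ, a < u.re → DifferentiableAt ℂ (fun y : ℂ ↦ (2 : ℂ) / (y - a)) u :=
    fun u hu ↦ DifferentiableAt.fun_div (differentiableAt_const _)
      (differentiableAt_id.sub_const _) (hsub_ne u hu)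
  have hΦd : DifferentiableOn ℂ Φ ({s : ℂ | 2 < s.re} ∪ W₀) := fun u hu ↦ by
    obtain ⟨hua, hζ₁⟩ := hdom u hu
    exact ((differentiableAt_continuation (by linarith) hζ₁).fun_add
      (hInv u hua)).differentiableWithinAt
  -- `Φ` agrees with the transform of `g` on `Re u > 2`
  have hagree : EqOn Φ (Landau.mellinIoi g) {s : ℂ | 2 < s.re} := by
    intro u hu
    have hu' : (2 : ℝ) < u.re := hu
    have hu1 : 1 < u.re := by linarith
    have hne := (hdom u (Or.inl hu)).2
    have hTi := integrable_ofReal_mul_cpow hmeasT hintT hu'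
    have hPi := integrable_ofReal_mul_cpow hmeasP hintP hu'
    have hsplit : Landau.mellinIoi g u =
        Landau.mellinIoi T u + Landau.mellinIoi (fun x : ℝ ↦ 2 * x ^ a) u := by
      simp only [Landau.mellinIoi]
      rw [← integral_add hTi hPi]
      refine setIntegral_congr_fun measurableSet_Ioi fun x _ ↦ ?_
      simp only [hg]
      push_cast
      ring
    rw [hsplit, mellinIoi_const_mul_rpow 2 a (by linarith), hΦ]
    simp only
    rw [← mellinIoi_mul_riemannZeta₁ hu1, mul_div_cancel_right₀ _ hne]
    push_cast
    ring
  -- Landau's lemma: absolute convergence of the transform of `g` at `σ > a`; subtract `2 x^a`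
  have hX₁ : (1 : ℝ) ≤ (N₁ : ℝ) + 1 := by
    have := (Nat.cast_nonneg N₁ : (0 : ℝ) ≤ N₁)
    linarith
  have hL := Landau.integrableOn_of_differentiableOn_union_convex hmeas hint hX₁ hpos
    (by linarith : a < 2) hW₀o hW₀c hW₀r hΦd hagree haσ
  have hcomp : IntegrableOn (fun x : ℝ ↦ 2 * x ^ a * x ^ (-(σ + 1))) (Ioi 1) :=
    integrableOn_const_mul_rpow_mul_rpow 2 haσ
  have hfun : (fun x ↦ T x * x ^ (-(σ + 1))) =
      fun x ↦ g x * x ^ (-(σ + 1)) - 2 * x ^ a * x ^ (-(σ + 1)) := by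
    funext x
    simp only [hg]
    ring
  rw [hfun]
  exact hL.sub hcomp

/-- **From `T(n) ≥ −n^{−1/2+ε}` (every `ε`) to the Riemann hypothesis** (Turán 1948, proof of
Theorem I, in the rate form of Ingham's review; Titchmarsh §14.38 for the case `T ≥ 0`). The
transform `∫₁^∞ T(x) x^{−(u+1)} dx` converges absolutely on `Re u > −1/2`
(`integrableOn_liouvilleHarmonicSum_rpow_of_ge_neg_rpow`), so
`(∫ T x^{−u−1}) · ζ₁(u+1) = ζ(2u+2)` persists there and `ζ(ρ) = 0` with `1/2 < Re ρ < 1` would force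
`ζ(2ρ) = 0` (the tree's `TuranLiouville.riemannZeta_ne_zero_of_integrable`); the zeros with
`Re ρ < 1/2` are excluded by the functional equation (`quasiRiemannHypothesis_one_half_iff_holds`).
[cite: Turan1948, Theorem I, proof (MR 10,286b)] [cite: Titchmarsh1986, §14.38] -/
theorem riemannHypothesis_of_liouvilleHarmonicSum_ge_neg_rpow
    (h : ∀ ε : ℝ, 0 < ε → ∃ N₁ : ℕ, ∀ n : ℕ, N₁ ≤ n →
      -(n : ℝ) ^ (-(1 / 2 : ℝ) + ε) ≤ liouvilleHarmonicSum n) :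
    RiemannHypothesis := by
  have hI : ∀ σ : ℝ, -1 / 2 < σ →
      IntegrableOn (fun x ↦ liouvilleHarmonicSum x * x ^ (-(σ + 1))) (Ioi 1) :=
    fun σ hσ ↦ integrableOn_liouvilleHarmonicSum_rpow_of_ge_neg_rpow h hσ
  have hQ : QuasiRiemannHypothesis (1 / 2) := fun ρ hρ h1 h2 ↦
    riemannZeta_ne_zero_of_integrable hI h1 h2 hρ
  exact (quasiRiemannHypothesis_one_half_iff_holds : QuasiRiemannHypothesis (1 / 2) ↔ _).1 hQ

end TuranLog3

open TuranLog3

/-! ### Turán's criterion for every rate `N^{−1/2+o(1)}`, and the discharge of `Turan1948_criterion_log3` -/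

/-- **Turán's criterion, rate form (Turán 1948 (I)/(IV) with `ϑ = 1/2`; Roy–Vatwani 2019, §1).**
If for all large `N` every zero of the section `ζ_N` has `Re s ≤ 1 + g(N)`
(`TuranHypothesisRate g`), where `g(N) ≤ N^{−1/2+ε}` for all large `N`, for every `ε > 0`, then the
Riemann hypothesis holds (Bohr–Kronecker transfer to the Liouville twist, descent to
`T(N) ≥ −N^{−1/2+ε}`, Landau's lemma; see the module docstring). By Montgomery 1983 the hypothesis
fails for every such `g` (`not_TuranHypothesisRate_of_montgomery`, granted `Montgomery1983_theorem`),
so the criterion, though proved here genuinely, has no true instance.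
[cite: RoyVatwani2019, §1 (arXiv p. 3)] [cite: Turan1948, Theorems I and IV (MR 10,286b)] -/
theorem riemannHypothesis_of_TuranHypothesisRate {g : ℕ → ℝ} (hZ : TuranHypothesisRate g)
    (hg : ∀ ε : ℝ, 0 < ε → ∃ N₁ : ℕ, ∀ N : ℕ, N₁ ≤ N → g N ≤ (N : ℝ) ^ (-(1 / 2 : ℝ) + ε)) :
    RiemannHypothesis :=
  riemannHypothesis_of_liouvilleHarmonicSum_ge_neg_rpow fun _ hε ↦
    liouvilleHarmonicSum_ge_neg_rpow_of_rate hZ hg hε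

/-- Turán's own rate is admissible: for every `ε > 0`, eventually `log³ N/√N ≤ N^{−1/2+ε}`
(`log³ N ≤ (1 + log N)⁴ ≤ N^ε`). [folklore] -/
theorem exists_log_pow_three_div_sqrt_le_rpow {ε : ℝ} (hε : 0 < ε) :
    ∃ N₁ : ℕ, ∀ N : ℕ, N₁ ≤ N → Real.log N ^ 3 / Real.sqrt N ≤ (N : ℝ) ^ (-(1 / 2 : ℝ) + ε) := by
  obtain ⟨N₁, hN₁⟩ := exists_mul_one_add_log_sq_le_rpow 1 (half_pos hε)
  refine ⟨max N₁ 3, fun N hN ↦ ?_⟩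
  have hN1 : N₁ ≤ N := le_trans (le_max_left _ _) hN
  have hN3 : (3 : ℝ) ≤ N := by exact_mod_cast le_trans (le_max_right _ _) hN
  have hNpos : (0 : ℝ) < N := by linarith
  have hlog1 : 1 ≤ Real.log N := by
    rw [← Real.log_exp 1]
    refine Real.log_le_log (Real.exp_pos 1) (le_trans ?_ hN3)
    have := Real.exp_one_lt_d9
    linarith
  have h1 := hN₁ N hN1
  rw [one_mul] at h1
  have hl3 : Real.log N ^ 3 ≤ ((1 + Real.log N) ^ 2) ^ 2 := by nlinarith
  have hsq : ((1 + Real.log N) ^ 2) ^ 2 ≤ ((N : ℝ) ^ (ε / 2)) ^ 2 :=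
    pow_le_pow_left₀ (sq_nonneg _) h1 2
  have hε2 : ((N : ℝ) ^ (ε / 2)) ^ 2 = (N : ℝ) ^ ε := by
    rw [← Real.rpow_natCast, ← Real.rpow_mul hNpos.le]
    norm_num
  have hsqrt : Real.sqrt N = (N : ℝ) ^ (1 / 2 : ℝ) := Real.sqrt_eq_rpow N
  rw [hsqrt, div_le_iff₀ (Real.rpow_pos_of_pos hNpos _), ← Real.rpow_add hNpos,
    show -(1 / 2 : ℝ) + ε + 1 / 2 = ε by ring]
  linarith

/-- **Discharge of `Turan1948_criterion_log3`** (Roy–Vatwani 2019, §1: "Turán … showed that if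
`ζ_N(s)` has no zeros in the half-plane `σ > 1 + (log N)³/√N` for all `N` sufficiently large, then
`ζ(s)` has no zeros in `σ > 1/2`"): `TuranHypothesisLog3 → RiemannHypothesis`, proved along Turán's
route (the module docstring), independently of the falsity of the hypothesis
(`Turan1948_criterion_log3_of_montgomeryThm`).
[cite: RoyVatwani2019, §1 (arXiv p. 3)] [cite: Turan1948, Theorems I and IV (MR 10,286b)] -/
theorem Turan1948_criterion_log3_holds : Turan1948_criterion_log3 := fun hL ↦
  riemannHypothesis_of_TuranHypothesisRate hL.rate fun _ hε ↦
    exists_log_pow_three_div_sqrt_le_rpow hε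

end Literature.Barriers.RiemannHypothesis
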